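import Summits.PneNP.PneNP.Theorems.PairwiseSALinear
import Summits.PneNP.PneNP.Theorems.IP3ExpandingExist
import Summits.PneNP.PneNP.Theorems.QuotientSAHeadline

/-!
# COR-A: pure `IP₃` range avoidance is linear-level Sherali–Adams blind at every constant stretch (cell `pnp-ideate`, ROUND-22)

FRONTIER range-avoidance ladder, rung F-N3 context (restricted-model lower bound for the Sherali–Adams hierarchy) — nothing here
bears on `P` vs `NP`.

`ip3SALinearBlind : QuotientSAHeadline.IP3SALinearBlind`, assembled BY NAME from the three suppliers of p3's wiring
`QuotientSAHeadline.ip3SALinearBlind_of`: the biased-BGMT hub `PairwiseSA.pairwiseSALinearLevel` (prover-2, T22.0), the `IP₃`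
fibre laws `IP3ExpandingExist.ip3PairwiseLaws'` (prover-1, T22.1a(i), `PstarIP3Law`) and the existence of `(n/c, 7/2)`-boundary
expanding pure-`IP₃` instances `IP3ExpandingExist.expandingIP3Exist'` (prover-1, T22.2-A).  Reading: for every stretch `C` there
is `c > 0` such that for infinitely many `n` some pure-`IP₃` `6`-local map (`u₀u₁ ⊕ u₂u₃ ⊕ u₄u₅`) with `C·n ≤ m` outputs has a point
outside its range while level-`n/c` Sherali–Adams is feasible for EVERY target — the predicate has NO linear part, so this
blindness is not of Grigoriev/XOR type (cell memo §11/§12).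
-/

set_option linter.dupNamespace false

namespace Summit.PneNP.PneNP.Theorems.QuotientSAHeadline

/-- **COR-A (ROUND-22).**  Pure-`IP₃` range avoidance is linear-level Sherali–Adams blind at every constant stretch.  Restricted-model
lower bound for a relaxation hierarchy; it says nothing about `P` versus `NP`. -/
theorem ip3SALinearBlind : IP3SALinearBlind :=
  ip3SALinearBlind_of PairwiseSA.pairwiseSALinearLevel IP3ExpandingExist.ip3PairwiseLaws' IP3ExpandingExist.expandingIP3Exist'

end Summit.PneNP.PneNP.Theorems.QuotientSAHeadline
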